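import Summits.ResolutionOfSingularities.ResolutionOfSingularities.Theorems.WildLogDiagonalLU3
import HarnessLib

/-!
# WildLogDiagonalLU4 — PART C/C′: THE CELL `WildLogDiagonalLUAbove k O`, THE PRODUCTION THEOREM `wildPseudoReflectionLUAbove_of_wildLogDiagonalLUAbove`, THE LAW `relLU_of_wildLogDiagonalLUAbove` (hypothesis-free, every `d`, every `p`), and the typed complement kinds `WildLogDiagonalUnluckyAbove` / `WildLogDiagonalMixedAbove` (UNDECIDED, with tests)

One of the five landing files of the g32 node «LogDiagonalCut» of the ROOT/RESIDUAL decomposition cell `decomp-res`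
(lens 1; door (W-wild-PROD) of NEXT-g32, critic letters 229a / 229b, ROW 234; files `WildLogDiagonalLU`, `…LU2`,
`…LU3`, `…LU4`, `…LU5`); see the module docstring of `Summits.ResolutionOfSingularities.ResolutionOfSingularities.Theorems.WildLogDiagonalLU`
for the thesis (the binomial log-diagonal wild `ℤ/p` cell decided hypothesis-free by PRODUCTION of the pseudo-reflection
model — toric chart + Frobenius normal form + Nakayama + derivation rule — then the g31 law / [KiralyLutkebohmert2013,
Thm. 2] BY NAME), the cell `WildLogDiagonalLUAbove k O` and the law `relLU_of_wildLogDiagonalLUAbove` (in `…LU4`), the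
toy census, the instances, the control certificate and the typed complement kinds, the honest scope and the sources.
This file: the cell (`def : Prop`, same audit class as the landed cells), the production theorem (ONE call of the chart theorem; `([K′:K] : k) = 0` USED for `CharP`), the law (ONE call of g31's `relLU_of_wildPseudoReflectionLUAbove`), the complement kinds and their inclusions.
Imports: the slice `…WildLogDiagonalLU3` (the g31 files `…WildReflectionLU2/3` come through `…WildLogDiagonalLU`'s import of the landed `…WildReflectionLU3`).  Problem side, sorry-free, hypothesis-free (zero fact binders); every heavy theorem carries
`set_option maxHeartbeats … in` BEFORE its docstring — keep it.
-/

noncomputable section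

open Literature.AlgebraicGeometry.Resolution
open Summit.ResolutionOfSingularities.ResolutionOfSingularities.Theorems.InertDescentLU
open Summit.ResolutionOfSingularities.ResolutionOfSingularities.Theorems.InvariantDescentLU
open Summit.ResolutionOfSingularities.ResolutionOfSingularities.Theorems.WildReflectionLU

universe u

namespace Summit.ResolutionOfSingularities.ResolutionOfSingularities.Theorems.WildLogDiagonalLU

variable {E : Type u} [Field E]

/-! ## PART C — THE CELL `WildLogDiagonalLUAbove k O` and its hypothesis-free LAW -/

section Law

open IsLocalRing Polynomial IntermediateField
open Summit.ResolutionOfSingularities.ResolutionOfSingularities.Theorems.TameQuotientLU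
open Summit.ResolutionOfSingularities.ResolutionOfSingularities.Theorems.TameAbelianQuotientLU

variable (k : Type) [Field k] {K : Type} [Field K] [Algebra k K]

/-- **THE BINOMIAL LOG-DIAGONAL WILD CELL** (tag DECIDED · a CELL, by the hypothesis-free law
`relLU_of_wildLogDiagonalLUAbove`; `ℤ/p`-layer, `p = char k`, with `p`-LUCKY frames cofinal).
TOP (verbatim the g31 cell `WildPseudoReflectionLUAbove`): `K′/K` Galois of PRIME degree equal to the characteristic
(`([K′:K] : k) = 0`), `O′` a `G`-STABLE prolongation of `O` (`G = G_Z`) with RESIDUES IN `k`.  MODEL CLAUSE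
(standard): above every f.g. birational `R ⊆ O` a `G`-stable f.g. model `M = ι(R)[t₀] ⊆ O′`, REGULAR at the centre,
CARRYING — on that model, not on an unnamed one — (F1)–(F3) a system `x₁ … x_d` generating the centre of
`B = M_𝔪′`, `d = dim B`; (F4)–(F5) a FRAME `x′₁ … x′_d ∈ 𝔪′ ∖ 0` of fractions of `M` of which the `xᵢ` are
monomials `∏ x′_j^{A i j}` (a monomial / Perron / Jacobi–Perron chart; `A = 1` allowed); (P) a PIVOT `η ∈ M`,
`η = w·∏ x′_j^{a′_j}`, `w ∈ B^×`, `v′η > 0`; (T) the BINOMIAL LOG-DIAGONAL ACTION of a `g ∈ G` on the frame,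
`g x′_j = x′_j·(1 + η)^{N_j}`; (L) the ARITHMETIC clause `Lucky [K′:K] N a′` on `(N, a′, p)` only.  NO
principal-augmentation clause, no clause on unnamed models: the pseudo-reflection is PRODUCED by the law.
Inhabitants: the g31 ARC instance (`η = π`, `N = (−1, 0, 0, 0)`), the g31 GOLDEN instance (Perron charts with `p`
dividing a continuant), the rank-3 tops `η₂ ↦ η₂(1 + η₁)^{−c}` with `p ∣ c` (module docstring §3).
[cite: KiralyLutkebohmert2013, Def. 1, Thm. 2 (a), Ex. 6] [cite: CossartPiltant2008, Lemma 9.4]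
[cite: LorenziniSchroer2019, Def. 6.9, Rem. 6.20] -/
def WildLogDiagonalLUAbove (O : ValuationSubring K) : Prop :=
  ∃ K' : IntermediateField K (AlgebraicClosure K), FiniteDimensional K K' ∧ IsGalois K K' ∧
    (Module.finrank K K').Prime ∧ ((Module.finrank K K' : ℕ) : k) = 0 ∧
    ∃ O' : ValuationSubring K', O'.comap (algebraMap K K') = O ∧
      (∀ g : K' ≃ₐ[K] K', ∀ y : K', y ∈ O' ↔ g y ∈ O') ∧
      (∀ y ∈ O', ∃ c : k, y - algebraMap k K' c ∈ O'.nonunits) ∧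
      ∀ R : Subalgebra k K, R.FG → IsFractionRing R K → R.toSubring ≤ O.toSubring →
        ∃ t₀ : Finset K', modelAbove k R K' t₀ ≤ O'.toSubring ∧
          (∀ g : K' ≃ₐ[K] K', ∀ y ∈ modelAbove k R K' t₀, g y ∈ modelAbove k R K' t₀) ∧
          IsRegularLocalRing (locAtCentre (modelAbove k R K' t₀) O') ∧
          ∃ d : ℕ, ∃ x x' : Fin d → K', ∃ A : Fin d → Fin d → ℕ, ∃ η w : K', ∃ a' : Fin d → ℕ,
          ∃ g : K' ≃ₐ[K] K', ∃ N : Fin d → ℤ,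
            ringKrullDim (locAtCentre (modelAbove k R K' t₀) O') = d ∧
            (∀ i, x i ∈ locAtCentre (modelAbove k R K' t₀) O' ∧ O'.valuation (x i) < 1) ∧
            (∀ b ∈ locAtCentre (modelAbove k R K' t₀) O', O'.valuation b < 1 →
              ∃ c : Fin d → K', (∀ i, c i ∈ locAtCentre (modelAbove k R K' t₀) O') ∧ b = ∑ i, c i * x i) ∧
            (∀ j, x' j ≠ 0 ∧ x' j ∈ O' ∧ O'.valuation (x' j) < 1 ∧
              ∃ a b : K', a ∈ modelAbove k R K' t₀ ∧ b ∈ modelAbove k R K' t₀ ∧ x' j = a / b) ∧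
            (∀ i, x i = ∏ j, x' j ^ A i j) ∧
            (η ∈ modelAbove k R K' t₀ ∧ O'.valuation η < 1 ∧ w ∈ locAtCentre (modelAbove k R K' t₀) O' ∧
              O'.valuation w = 1 ∧ η = w * ∏ j, x' j ^ a' j) ∧
            (∀ j, g (x' j) = x' j * (1 + η) ^ (N j)) ∧
            Lucky (Module.finrank K K') N a'

variable {k}

set_option maxHeartbeats 1600000 in
/-- **THE PRODUCTION LAW** (hypothesis-free, every `d`, every `p`):
`WildLogDiagonalLUAbove k O → WildPseudoReflectionLUAbove k O` — the kernel PRODUCES, above every f.g. model of `K`,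
the `G`-stable regular model `ι(R)[t₀, x′, (1 + gⁱη)⁻¹]` and its pseudo-reflection generator `x′_{j₀}` (the lucky
coordinate) by `chart_isRegularLocalRing_and_generates`; characteristic `p` upstairs comes from `([K′:K] : k) = 0`
(`CharP.ringChar_of_prime_eq_zero`, `charP_of_injective_algebraMap`) — the clause g31's law did not use is USED here;
`g ≠ 1` generates `G` (`mem_powers_of_prime_card`), so `g`-stability is `G`-stability.
[cite: KiralyLutkebohmert2013, Thm. 2 (a), Ex. 6] [cite: CossartPiltant2008, Lemma 9.4] -/
theorem wildPseudoReflectionLUAbove_of_wildLogDiagonalLUAbove {O : ValuationSubring K}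
    (h : WildLogDiagonalLUAbove k O) : WildReflectionLU.WildPseudoReflectionLUAbove k O := by
  classical
  obtain ⟨K', hfd, hgal, hprime, hchar, O', hO'O, hGO', hκ', hLU⟩ := h
  haveI := hfd
  haveI := hgal
  refine ⟨K', hfd, hgal, hprime, hchar, O', hO'O, hGO', fun R hRfg hRfrac hRO => ?_⟩
  obtain ⟨t₀, hMO, hGM, hreg, d, x, x', A, η, w, a', g, N, hdim, hx, hgen, hx', hmon, hpiv, htw, hL⟩ :=
    hLU R hRfg hRfrac hRO
  -- the prime `p = [K′ : K] = char k = char K′`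
  set p : ℕ := Module.finrank K K' with hpdef
  haveI hpF : Fact p.Prime := ⟨hprime⟩
  haveI : CharP k p := ringChar.of_eq (CharP.ringChar_of_prime_eq_zero hprime hchar)
  haveI : CharP K' p := charP_of_injective_algebraMap (algebraMap k K').injective p
  let ι : K →+* K' := (algebraMap K K' : K →+* K')
  have hfk : ∀ c : k, ι (algebraMap k K c) = algebraMap k K' c := fun c =>
    (IsScalarTower.algebraMap_apply k K K' c).symm
  -- the base `S′ = ι(R)` and the model `M = ι(R)[t₀]`
  set S' : Subring K' := R.toSubring.map ι with hS'def
  set M : Subring K' := modelAbove k R K' t₀ with hMdef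
  have hS'M : S' ≤ M := fun s hs => Subring.subset_closure (Or.inl hs)
  have hRS : ∀ y ∈ R, ι y ∈ S' := fun y hy => Subring.mem_map.mpr ⟨y, hy, rfl⟩
  have hkS : ∀ c : k, algebraMap k K' c ∈ S' := fun c => by
    rw [← hfk]
    exact hRS _ (R.algebraMap_mem c)
  -- the generator `σ = g` as a ring automorphism: fixes `S′`, preserves `O′` and `M`, `σ^p = 1`
  set σ : K' ≃+* K' := (g : K' ≃+* K') with hσdef
  have hσO : ∀ z : K', z ∈ O' ↔ σ z ∈ O' := hGO' g
  have hσS : ∀ s ∈ S', σ s = s := by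
    intro s hs
    obtain ⟨y, -, rfl⟩ := Subring.mem_map.mp hs
    exact g.commutes y
  have hσM : ∀ z ∈ M, σ z ∈ M := hGM g
  have hcard : Nat.card (K' ≃ₐ[K] K') = p := IsGalois.card_aut_eq_finrank K K'
  have hcoe1 : ((1 : K' ≃ₐ[K] K') : K' ≃+* K') = 1 := RingEquiv.ext fun _ => rfl
  have hcoemul : ∀ g g' : K' ≃ₐ[K] K', ((g * g' : K' ≃ₐ[K] K') : K' ≃+* K') =
      (g : K' ≃+* K') * (g' : K' ≃+* K') := fun _ _ => RingEquiv.ext fun _ => rfl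
  have hcoepow : ∀ (g : K' ≃ₐ[K] K') (n : ℕ), ((g ^ n : K' ≃ₐ[K] K') : K' ≃+* K') = (g : K' ≃+* K') ^ n := by
    intro g n
    induction n with
    | zero => rw [pow_zero, pow_zero, hcoe1]
    | succ n ih => rw [pow_succ, pow_succ, hcoemul, ih]
  have hσp : σ ^ p = 1 := by
    have hgp : g ^ p = 1 := by rw [← hcard]; exact pow_card_eq_one'
    rw [hσdef, ← hcoepow, hgp, hcoe1]
  -- universally catenary local ring of the model; residues in `S′`
  haveI : Algebra.FiniteType k R := (Subalgebra.fg_iff_finiteType R).mp hRfg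
  have hSuc : IsUniversallyCatenaryRing S' :=
    (isUniversallyCatenaryRing_of_finiteType_field k R).of_surjective (ι.restrict R S' hRS) (by
      rintro ⟨y, hy⟩
      obtain ⟨z, hz, rfl⟩ := Subring.mem_map.mp hy
      exact ⟨⟨z, hz⟩, rfl⟩)
  have hMuc : IsUniversallyCatenaryRing (locAtCentre M O') :=
    isUniversallyCatenaryRing_locAtCentre_closure O' S' hSuc t₀ hMO
  have hres : ∀ y ∈ O', ∃ c ∈ S', O'.valuation (y - c) < 1 := fun y hy => by
    obtain ⟨c, hc⟩ := hκ' y hy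
    exact ⟨algebraMap k K' c, hkS c, (O'.mem_nonunits_iff).mp hc⟩
  -- THE CHART (PART B) on the model `M′ = ι(R)[t₀ ∪ x′ ∪ (1 + gⁱη)⁻¹]`
  let zf : Fin p → K' := fun i => (1 + (σ ^ (i : ℕ)) η)⁻¹
  let t₁ : Finset K' := t₀ ∪ Finset.univ.image x' ∪ Finset.univ.image zf
  have hT' : modelAbove k R K' t₁ =
      Subring.closure ((M : Set K') ∪ (Set.range x' ∪ Set.range zf)) := by
    refine le_antisymm (Subring.closure_le.mpr ?_) (Subring.closure_le.mpr ?_)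
    · rintro y (hy | hy)
      · exact Subring.subset_closure (Or.inl (hS'M hy))
      · have hy' : y ∈ t₀ ∨ (∃ j, x' j = y) ∨ ∃ i, zf i = y := by
          simpa [t₁, Finset.mem_union, Finset.mem_image] using hy
        rcases hy' with hy | ⟨j, rfl⟩ | ⟨i, rfl⟩
        · exact Subring.subset_closure (Or.inl (Subring.subset_closure (Or.inr hy)))
        · exact Subring.subset_closure (Or.inr (Or.inl ⟨j, rfl⟩))
        · exact Subring.subset_closure (Or.inr (Or.inr ⟨i, rfl⟩))
    · rintro y (hy | ⟨j, rfl⟩ | ⟨i, rfl⟩)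
      · exact Subring.closure_mono (Set.union_subset_union_right _ (by
          intro u hu
          simp only [Finset.mem_coe] at hu ⊢
          simp [t₁, hu])) hy
      · exact Subring.subset_closure (Or.inr (by simp [t₁]))
      · exact Subring.subset_closure (Or.inr (by simp [t₁]))
  have htw' : ∀ j, σ (x' j) = x' j * (1 + η) ^ N j := htw
  obtain ⟨hT'O, hσT', hreg', j₀, hyT', hne, hPR⟩ :=
    chart_isRegularLocalRing_and_generates O' p hσO hσp hS'M hσS hMO hσM hreg hMuc hres hdim hx hgen hx'
      hmon hpiv htw' hL (modelAbove k R K' t₁) hT'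
  have hg1 : g ≠ 1 := by
    rintro rfl
    exact hne rfl
  refine ⟨t₁, hT'O, fun g' y hy => ?_, hreg', g, x' j₀, hyT', hne, hPR⟩
  -- every `g′ ∈ G` is a power of `g` (prime order), so `g`-stability is `G`-stability
  obtain ⟨m, rfl⟩ := (Submonoid.mem_powers_iff _ _).mp (mem_powers_of_prime_card hcard hg1 (g' := g'))
  rw [← toRingEquiv_pow_apply]
  exact pow_apply_mem_of_stable hσT' m hy

/-- **THE LAW OF THE BINOMIAL LOG-DIAGONAL WILD CELL** (hypothesis-free, every `d`, every `p`):
`WildLogDiagonalLUAbove k O → RelLocalUniformization k K O` — production (this file) then descent by the g31 law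
`WildReflectionLU.relLU_of_wildPseudoReflectionLUAbove` BY NAME (= [KiralyLutkebohmert2013, Thm. 2 (a) ⇒ (d)] from
the tree, Artin–Tate, transport). [cite: KiralyLutkebohmert2013, Thm. 2] [cite: CossartPiltant2008, Lemma 9.4] -/
theorem relLU_of_wildLogDiagonalLUAbove {O : ValuationSubring K} (h : WildLogDiagonalLUAbove k O) :
    RelLocalUniformization k K O :=
  WildReflectionLU.relLU_of_wildPseudoReflectionLUAbove (wildPseudoReflectionLUAbove_of_wildLogDiagonalLUAbove h)

end Law


/-! ## PART C′ — THE TYPED COMPLEMENT KINDS inside the log-diagonal world (tag UNDECIDED, with TESTS) -/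

section Complements

open IsLocalRing Polynomial IntermediateField
open Summit.ResolutionOfSingularities.ResolutionOfSingularities.Theorems.TameQuotientLU

variable (k : Type) [Field k] {K : Type} [Field K] [Algebra k K]

/-- **COMPLEMENT KIND (λ′) — BINOMIAL LOG-DIAGONAL, LUCK NOT ASSERTED** (tag UNDECIDED · a KIND, not a cell):
verbatim the cell `WildLogDiagonalLUAbove` with the arithmetic clause (L) `Lucky [K′:K] N a′` REPLACED by the bare
non-triviality `∃ j, N_j ≠ 0` of the twist.  It CONTAINS the cell (`wildLogDiagonalUnluckyAbove_of_wildLogDiagonalLUAbove`)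
and, beyond it, the `p`-UNLUCKY binomial tops: binomial shape on cofinal frames, `Lucky` false on every monomial
chart (registry control `p = 5`, `γ = [0; 3, 1̄]`: `control_not_lucky`; its `d ≥ 3` non-Abhyankar relatives
obtained by adjoining fixed arc coordinates).  There NO monomial chart is a pseudo-reflection model (the augmentation
ideal of a binomial chart is the MONOMIAL ideal `(x′_j η^{p^{v_p N_j}})_j`, principal iff lucky — exponent
comparison in the regular local ring `B′`, «a principal ideal of a local ring is generated by one of any generating
set») and by [KiralyLutkebohmert2013, Thm. 2 (d) ⇒ (a)] no monomial chart has a regular ring of invariants.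
TEST (what would DECIDE the kind, a later +1 door): a hypothesis-free law
`WildLogDiagonalUnluckyAbove k O → RelLocalUniformization k K O`, necessarily by a NON-monomial `G`-stable
modification producing a pseudo-reflection model, or by resolving the (singular, wild) quotient of an unlucky chart
downstairs (`d = 2` Lipman, `d = 3` [CossartPiltant2019], `d ≥ 4` OPEN); FIRST INSTANCE to decide: `p = 5`,
`K′ = k(η₁, η₂, z₃, …, z_d)`, `g η₁ = η₁(1 + η₂)`, `g` trivial on `η₂, z`, `O′` = the monomial valuation
`v(η₁) = 1`, `v(η₂) = [0; 3, 1̄]·v(η₁)` composed with a NON-Abhyankar arc valuation in the `z`'s.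
[cite: KiralyLutkebohmert2013, Thm. 2, Conj. 10 (arXiv:1001.1945 numbering)] [cite: Artin1975]
[cite: CossartPiltant2019] -/
def WildLogDiagonalUnluckyAbove (O : ValuationSubring K) : Prop :=
  ∃ K' : IntermediateField K (AlgebraicClosure K), FiniteDimensional K K' ∧ IsGalois K K' ∧
    (Module.finrank K K').Prime ∧ ((Module.finrank K K' : ℕ) : k) = 0 ∧
    ∃ O' : ValuationSubring K', O'.comap (algebraMap K K') = O ∧
      (∀ g : K' ≃ₐ[K] K', ∀ y : K', y ∈ O' ↔ g y ∈ O') ∧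
      (∀ y ∈ O', ∃ c : k, y - algebraMap k K' c ∈ O'.nonunits) ∧
      ∀ R : Subalgebra k K, R.FG → IsFractionRing R K → R.toSubring ≤ O.toSubring →
        ∃ t₀ : Finset K', modelAbove k R K' t₀ ≤ O'.toSubring ∧
          (∀ g : K' ≃ₐ[K] K', ∀ y ∈ modelAbove k R K' t₀, g y ∈ modelAbove k R K' t₀) ∧
          IsRegularLocalRing (locAtCentre (modelAbove k R K' t₀) O') ∧
          ∃ d : ℕ, ∃ x x' : Fin d → K', ∃ A : Fin d → Fin d → ℕ, ∃ η w : K', ∃ a' : Fin d → ℕ,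
          ∃ g : K' ≃ₐ[K] K', ∃ N : Fin d → ℤ,
            ringKrullDim (locAtCentre (modelAbove k R K' t₀) O') = d ∧
            (∀ i, x i ∈ locAtCentre (modelAbove k R K' t₀) O' ∧ O'.valuation (x i) < 1) ∧
            (∀ b ∈ locAtCentre (modelAbove k R K' t₀) O', O'.valuation b < 1 →
              ∃ c : Fin d → K', (∀ i, c i ∈ locAtCentre (modelAbove k R K' t₀) O') ∧ b = ∑ i, c i * x i) ∧
            (∀ j, x' j ≠ 0 ∧ x' j ∈ O' ∧ O'.valuation (x' j) < 1 ∧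
              ∃ a b : K', a ∈ modelAbove k R K' t₀ ∧ b ∈ modelAbove k R K' t₀ ∧ x' j = a / b) ∧
            (∀ i, x i = ∏ j, x' j ^ A i j) ∧
            (η ∈ modelAbove k R K' t₀ ∧ O'.valuation η < 1 ∧ w ∈ locAtCentre (modelAbove k R K' t₀) O' ∧
              O'.valuation w = 1 ∧ η = w * ∏ j, x' j ^ a' j) ∧
            (∀ j, g (x' j) = x' j * (1 + η) ^ (N j)) ∧
            ∃ j, N j ≠ 0

/-- **COMPLEMENT KIND (λ″) — MIXED-UNIT LOG-DIAGONAL** (tag UNDECIDED · a KIND): the frame clauses (F1)–(F5) of the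
cell verbatim, the action clause WEAKENED to the general log-diagonal shape `g x′_j = x′_j·u_j` with `u_j` UNITS
of `B = M_𝔪′` (no pivot, no binomial normal form), one coordinate genuinely moved.  It CONTAINS the kind (λ′)
(`wildLogDiagonalMixedAbove_of_wildLogDiagonalUnluckyAbove`), hence the cell.  Census (c) of the notice: for
`u = (1 + η)^{p−1}(1 + η + η²x₃)`-type mixed units the augmentation `x^c(u^c − 1)` of a chart monomial has NO
`p`-adic normal form (initial form `η² x₃` at `c = p`, not a power of one principal unit) — the Frobenius
mechanism of this file does not apply.  TEST: a hypothesis-free law `WildLogDiagonalMixedAbove k O →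
RelLocalUniformization k K O`; first instance to decide: `d = 3`, `p = 3`, `g x₁ = x₁(1 + η)²(1 + η + η² x₃)`,
`η = x₂`, `g` trivial on `x₂, x₃`, extended to a non-Abhyankar place.  (LS's «moderately ramified» actions,
Def. 6.9 — fixed scheme = the closed point — are the ADDITIVE twin `g x = x + (higher)`, NOT of this shape; they
stay in R32's remainder (β′).) [cite: KiralyLutkebohmert2013, Thm. 2] [cite: LorenziniSchroer2019, Def. 6.9,
Thm. 6.10] -/
def WildLogDiagonalMixedAbove (O : ValuationSubring K) : Prop :=
  ∃ K' : IntermediateField K (AlgebraicClosure K), FiniteDimensional K K' ∧ IsGalois K K' ∧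
    (Module.finrank K K').Prime ∧ ((Module.finrank K K' : ℕ) : k) = 0 ∧
    ∃ O' : ValuationSubring K', O'.comap (algebraMap K K') = O ∧
      (∀ g : K' ≃ₐ[K] K', ∀ y : K', y ∈ O' ↔ g y ∈ O') ∧
      (∀ y ∈ O', ∃ c : k, y - algebraMap k K' c ∈ O'.nonunits) ∧
      ∀ R : Subalgebra k K, R.FG → IsFractionRing R K → R.toSubring ≤ O.toSubring →
        ∃ t₀ : Finset K', modelAbove k R K' t₀ ≤ O'.toSubring ∧
          (∀ g : K' ≃ₐ[K] K', ∀ y ∈ modelAbove k R K' t₀, g y ∈ modelAbove k R K' t₀) ∧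
          IsRegularLocalRing (locAtCentre (modelAbove k R K' t₀) O') ∧
          ∃ d : ℕ, ∃ x x' : Fin d → K', ∃ A : Fin d → Fin d → ℕ, ∃ g : K' ≃ₐ[K] K',
            ringKrullDim (locAtCentre (modelAbove k R K' t₀) O') = d ∧
            (∀ i, x i ∈ locAtCentre (modelAbove k R K' t₀) O' ∧ O'.valuation (x i) < 1) ∧
            (∀ b ∈ locAtCentre (modelAbove k R K' t₀) O', O'.valuation b < 1 →
              ∃ c : Fin d → K', (∀ i, c i ∈ locAtCentre (modelAbove k R K' t₀) O') ∧ b = ∑ i, c i * x i) ∧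
            (∀ j, x' j ≠ 0 ∧ x' j ∈ O' ∧ O'.valuation (x' j) < 1 ∧
              ∃ a b : K', a ∈ modelAbove k R K' t₀ ∧ b ∈ modelAbove k R K' t₀ ∧ x' j = a / b) ∧
            (∀ i, x i = ∏ j, x' j ^ A i j) ∧
            (∀ j, ∃ u : K', u ∈ locAtCentre (modelAbove k R K' t₀) O' ∧
              u⁻¹ ∈ locAtCentre (modelAbove k R K' t₀) O' ∧ g (x' j) = x' j * u) ∧
            ∃ j, g (x' j) ≠ x' j

variable {k}

/-- A lucky twist vector moves its lucky coordinate: `Lucky p N a′ → ∃ j, N_j ≠ 0` (for `p ≠ 1`; with `N_{j₀} = 0`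
the quotient `N_{j₀}/p^{e₀} = 0` would be divisible by `p`). [folklore] -/
theorem exists_ne_zero_of_lucky {p : ℕ} {d : ℕ} {N : Fin d → ℤ} {a' : Fin d → ℕ} (hL : Lucky p N a') :
    ∃ j, N j ≠ 0 := by
  obtain ⟨j₀, e₀, -, hm, -, -⟩ := hL
  refine ⟨j₀, fun h0 => hm ?_⟩
  rw [h0, Int.zero_ediv]
  exact dvd_zero _

/-- The cell lies in the complement kind (λ′) (drop luck, keep the non-triviality it implies). [folklore] -/
theorem wildLogDiagonalUnluckyAbove_of_wildLogDiagonalLUAbove {O : ValuationSubring K}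
    (h : WildLogDiagonalLUAbove k O) : WildLogDiagonalUnluckyAbove k O := by
  obtain ⟨K', hfd, hgal, hprime, hchar, O', hO'O, hGO', hκ', hLU⟩ := h
  refine ⟨K', hfd, hgal, hprime, hchar, O', hO'O, hGO', hκ', fun R hRfg hRfrac hRO => ?_⟩
  obtain ⟨t₀, hMO, hGM, hreg, d, x, x', A, η, w, a', g, N, hdim, hx, hgen, hx', hmon, hpiv, htw, hL⟩ :=
    hLU R hRfg hRfrac hRO
  exact ⟨t₀, hMO, hGM, hreg, d, x, x', A, η, w, a', g, N, hdim, hx, hgen, hx', hmon, hpiv, htw,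
    exists_ne_zero_of_lucky hL⟩

set_option maxHeartbeats 400000 in
/-- The kind (λ′) lies in the mixed-unit kind (λ″): `u_j := (1 + η)^{N_j}` is a unit of `B` (`1 + η ∈ M`,
`v′(1 + η) = 1`), and a coordinate with `N_j ≠ 0` is MOVED because `1 + η` is not a root of unity in characteristic
`p` (`one_add_zpow_ne_one` — the Frobenius normal form; `p = char k` USED). [folklore] -/
theorem wildLogDiagonalMixedAbove_of_wildLogDiagonalUnluckyAbove {O : ValuationSubring K}
    (h : WildLogDiagonalUnluckyAbove k O) : WildLogDiagonalMixedAbove k O := by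
  classical
  obtain ⟨K', hfd, hgal, hprime, hchar, O', hO'O, hGO', hκ', hLU⟩ := h
  refine ⟨K', hfd, hgal, hprime, hchar, O', hO'O, hGO', hκ', fun R hRfg hRfrac hRO => ?_⟩
  obtain ⟨t₀, hMO, hGM, hreg, d, x, x', A, η, w, a', g, N, hdim, hx, hgen, hx', hmon, hpiv, htw, j₁, hj₁⟩ :=
    hLU R hRfg hRfrac hRO
  set p : ℕ := Module.finrank K K' with hpdef
  haveI hpF : Fact p.Prime := ⟨hprime⟩
  haveI : CharP k p := ringChar.of_eq (CharP.ringChar_of_prime_eq_zero hprime hchar)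
  haveI : CharP K' p := charP_of_injective_algebraMap (algebraMap k K').injective p
  obtain ⟨hηM, hηv, hwB, hwv, hηeq⟩ := hpiv
  set M : Subring K' := modelAbove k R K' t₀ with hMdef
  have h1M : (1 + η) ∈ locAtCentre M O' := le_locAtCentre M O' (M.add_mem M.one_mem hηM)
  have h1inv : (1 + η)⁻¹ ∈ locAtCentre M O' := inv_mem_locAtCentre h1M (valuation_one_add_eq_one O' hηv)
  have hη0 : η ≠ 0 := by
    rw [hηeq]
    exact mul_ne_zero (ne_zero_of_valuation_eq_one hwv)
      (Finset.prod_ne_zero_iff.mpr fun j _ => pow_ne_zero _ (hx' j).1)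
  refine ⟨t₀, hMO, hGM, hreg, d, x, x', A, g, hdim, hx, hgen, hx', hmon, fun j => ?_, j₁, fun e => ?_⟩
  · refine ⟨(1 + η) ^ N j, zpow_mem_of_inv_mem _ h1M h1inv (N j), ?_, htw j⟩
    rw [← zpow_neg]
    exact zpow_mem_of_inv_mem _ h1M h1inv (-N j)
  · rw [htw j₁] at e
    have h1 : (1 + η) ^ N j₁ = 1 :=
      mul_left_cancel₀ (hx' j₁).1 (e.trans (mul_one (x' j₁)).symm)
    exact one_add_zpow_ne_one O' p (hMO hηM) hηv hη0 hj₁ h1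

end Complements

end Summit.ResolutionOfSingularities.ResolutionOfSingularities.Theorems.WildLogDiagonalLU

end
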